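import Summits.BirchSwinnertonDyer.BirchSwinnertonDyer.Theorems.ErratumRoadFiveIMCDivRoadFFFittingCutDefs
import Summits.BirchSwinnertonDyer.BirchSwinnertonDyer.Theorems.ErratumRoadFiveIMCDivCongruenceCoefficientDescentLe
import Summits.BirchSwinnertonDyer.BirchSwinnertonDyer.Theorems.ErratumRoadFiveIMCDivRoadFFAssemblyDefs
import HarnessLib

/-!
# Route `ErratumRoadFive`, crux `IMCDivAtErratumDataAll` (item stmt-BirchSwinnertonDyer-19270):
# FEEDING the coefficient-free Road FF predicate `P2.RoadFF.FittingCongruenceFrameAt` from Hida members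
# with their OWN coefficient rings, and from the member-level cut of record

Cell `bsd-stepL` (run/shared/lean/pub/bsd-stepL/), seat `bsd-stepL-imc-p1` (prover, session g8);
`--supports stmt-BirchSwinnertonDyer-19270 --as helper`. THEOREMS ONLY; no definition, no named fact, no
`sorry`; nothing asserted about any curve; closes nothing by itself.

* `P2.RoadFF.fittingCongruenceFrameAt_of_members_descent_le` — an `R₀`-frame `(Ω_K, Ω_p, L)` for `f`,
  `L^Σ` with `L·φ(P_Σ) ∣ L^Σ`, and for every `m ≥ 1` a member over its own coefficient square
  `Λ → R'_m →(φ'_m) S'_m ← R₀⟦T⟧` (`S'_m` faithfully flat): finite `R'_m`-module `N_m`,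
  `(R'_m ⊗_Λ X^Σ)/p^m ≅ N_m/p^m` [(b)+Lemma 2.1], `Fitt_{R'_m}(N_m)·S'_m ⊆ (L_m)` [(2.5)_m],
  `(L_m) ⊆ (L^Σ) + (p^m)` in `S'_m` [(c)] ⟹ `P2.RoadFF.FittingCongruenceFrameAt W p κ 𝔭 γ ι f S PS`
  (this seat's `AcSelmer.XAc.map_fittingIdeal_le_span_of_oneSided_congruences_descent_le`);
* `…_of_members_descent_le_printed` — the same with (2.5)_m in its PRINTED shape
  "`N_m` torsion → `Ch_{R'_m}(N_m)·S'_m ⊆ (L_m)`" over Noetherian UFDs `R'_m = 𝒪_m⟦T⟧` [FW21 4.41];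
* `P2.RoadFF.sigmaDataAt_of_memberSupplyAt` ∕ `P2.RoadFF.fittingCongruenceFrameAt_of_roadFF` — the
  member-level cut of record (`Theorems/ErratumRoadFiveIMCDivRoadFFAssemblyDefs.lean`, members over the
  single ring `Λ`, `d = 1`) feeds both coefficient-free predicates: `Λ`-members are members over the
  trivial coefficient square `Λ → Λ → R₀⟦T⟧ ← R₀⟦T⟧` (via `TensorProduct.lid`, `CongruenceDescent.nonempty_quotEquiv_of_lid`).

References: [Castella2018Erratum] (b), (c), Lemma 2.1, (2.5), proof of Thm. 1.1 (pp. 2–4);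
[Skinner2016PacificMC] §2.6, §3.1 (p. 192); [Castella2018] Thm. 3.1, (3.1), (4.1); [FouquetWan2021] Thm. 4.41
(shape only).
-/

set_option autoImplicit false

noncomputable section

open scoped Classical TensorProduct

open WeierstrassCurve NumberField IsDedekindDomain Field PowerSeries
open Literature.NumberTheory.EllipticCurves Literature.NumberTheory.EllipticCurves.GreenbergSelmer
  Literature.NumberTheory.EllipticCurves.ModularForms Literature.NumberTheory.EllipticCurves.Rank1Residual
  Literature.NumberTheory.EllipticCurves.Rank1Residual.Typed Literature.NumberTheory.EllipticCurves.Castella2018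
  Literature.NumberTheory.EllipticCurves.Module Literature.NumberTheory.GaloisRepresentations
  Literature.NumberTheory.GaloisCohomology Literature.RingTheory.FittingIdeal
open Summit.BirchSwinnertonDyer.Rank1Residual.X11b.AcSelmer Summit.BirchSwinnertonDyer.Rank1Residual.X11b.Halves
  Summit.BirchSwinnertonDyer.Rank1Residual.X2

namespace Summit.BirchSwinnertonDyer.Rank1Residual.X11b

section Feed

variable {K : Type} [Field K] [NumberField K] {W : WeierstrassCurve ℚ} [W.IsElliptic] {p : ℕ}
  [Fact p.Prime] {κ : ZpExtension K p} {𝔭 : HeightOneSpectrum (𝓞 K)} {γ : Field.absoluteGaloisGroup K}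
  [Fact (κ.IsTopGenerator γ)] {ι : PadicAlgCl p ≃+* ℂ} {N : ℕ}
  {f : CuspForm (CongruenceSubgroup.Gamma0 N) 2}
  {S : Set (HeightOneSpectrum (𝓞 K))} {PS : IwasawaAlgebra p}

universe v w

/-- **Hida members with their OWN coefficient rings feed the Fitting-level congruence frame.** An
`R₀`-frame `(Ω_K ≠ 0, Ω_p, L)` with `IsBDPLFunction ι 𝔭 κ γ f Ω_K Ω_p L` [Cas18 Thm. 3.1], `L^Σ` with
`L·φ(P_Σ) ∣ L^Σ` [Cas18 (3.1)], `Σ` finite, and for every `m ≥ 1` a coefficient square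
`Λ → R'_m →(φ'_m) S'_m ← R₀⟦T⟧` with `S'_m` faithfully flat over `R₀⟦T⟧`, a finite `R'_m`-module `N_m`, an
`R'_m`-isomorphism `(R'_m ⊗_Λ X^Σ)/p^m ≅ N_m/p^m` [(b) + Lemma 2.1], `Fitt_{R'_m}(N_m)·S'_m ⊆ (L_m)`
[(2.5)_m] and `(L_m) ⊆ (L^Σ) + (p^m)` in `S'_m` [(c)] ⟹ `P2.RoadFF.FittingCongruenceFrameAt W p κ 𝔭 γ ι f S PS`.
CONDITIONAL on the displayed inputs. [cite: Castella2018Erratum, proof of Thm. 1.1 (p. 4), read one-sidedly]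
[cite: Skinner2016PacificMC, §3.1 (p. 192)] -/
theorem P2.RoadFF.fittingCongruenceFrameAt_of_members_descent_le {ΩK : ℂ} {Ωp : (unrIntegers p)ˣ}
    {L : UnrSeries p} (hΩ : ΩK ≠ 0)
    (hL : IsBDPLFunction ι 𝔭 κ γ f ΩK ((Ωp : unrIntegers p) : ℂ_[p]) L)
    (LS : UnrSeries p) (hLS : L * PowerSeries.map (toUnr p) PS ∣ LS) (hS : S.Finite)
    (R' : ℕ → Type v) [∀ m, CommRing (R' m)] [∀ m, Algebra (IwasawaAlgebra p) (R' m)]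
    (S' : ℕ → Type w) [∀ m, CommRing (S' m)] [∀ m, Algebra (UnrSeries p) (S' m)]
    [∀ m, Module.FaithfullyFlat (UnrSeries p) (S' m)] (φ' : ∀ m, R' m →+* S' m)
    (hφ' : ∀ m, (φ' m).comp (algebraMap (IwasawaAlgebra p) (R' m)) =
      (algebraMap (UnrSeries p) (S' m)).comp (PowerSeries.map (toUnr p)))
    (Nm : ℕ → Type) [∀ m, AddCommGroup (Nm m)] [∀ m, Module (R' m) (Nm m)]
    [∀ m, Module.Finite (R' m) (Nm m)] (Lm : ∀ m, S' m)
    (e : ∀ m : ℕ, 1 ≤ m →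
      (((R' m ⊗[IwasawaAlgebra p] XAc (W.baseChange K) p κ 𝔭 S γ) ⧸
          (((Ideal.span {(PowerSeries.C (p : ℤ_[p]) : IwasawaAlgebra p)}).map
              (algebraMap (IwasawaAlgebra p) (R' m))) ^ m •
            (⊤ : Submodule (R' m) (R' m ⊗[IwasawaAlgebra p] XAc (W.baseChange K) p κ 𝔭 S γ))))
          ≃ₗ[R' m]
        (Nm m ⧸ (((Ideal.span {(PowerSeries.C (p : ℤ_[p]) : IwasawaAlgebra p)}).map
            (algebraMap (IwasawaAlgebra p) (R' m))) ^ m • (⊤ : Submodule (R' m) (Nm m))))))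
    (hF : ∀ m : ℕ, 1 ≤ m → (Module.fittingIdeal (R' m) (Nm m) 0).map (φ' m) ≤ Ideal.span {Lm m})
    (hc : ∀ m : ℕ, 1 ≤ m →
      Ideal.span {Lm m} ≤
        Ideal.span {algebraMap (UnrSeries p) (S' m) LS} ⊔
          (((Ideal.span {(PowerSeries.C (p : ℤ_[p]) : IwasawaAlgebra p)}).map
              (PowerSeries.map (toUnr p))).map (algebraMap (UnrSeries p) (S' m))) ^ m) :
    P2.RoadFF.FittingCongruenceFrameAt W p κ 𝔭 γ ι f S PS :=
  ⟨ΩK, Ωp, L, LS, hΩ, hL, hLS,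
    AcSelmer.XAc.map_fittingIdeal_le_span_of_oneSided_congruences_descent_le (W.baseChange K) p κ 𝔭 γ
      hS LS R' S' φ' hφ' Nm Lm e hF hc⟩

/-- **The same feed with (2.5)_m in its PRINTED shape** "`N_m` torsion → `Ch_{R'_m}(N_m)·S'_m ⊆ (L_m)`"
over Noetherian UFDs `R'_m` (`= 𝒪_m⟦T⟧`) [FW21 Thm. 4.41 at `p ∥ N`, PREPRINT]. CONDITIONAL on the inputs.
[cite: Castella2018Erratum, (2.5) and proof of Thm. 1.1 (p. 4), read one-sidedly]
[cite: FouquetWan2021, Thm. 4.41 (shape of the conclusion)] -/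
theorem P2.RoadFF.fittingCongruenceFrameAt_of_members_descent_le_printed {ΩK : ℂ}
    {Ωp : (unrIntegers p)ˣ} {L : UnrSeries p} (hΩ : ΩK ≠ 0)
    (hL : IsBDPLFunction ι 𝔭 κ γ f ΩK ((Ωp : unrIntegers p) : ℂ_[p]) L)
    (LS : UnrSeries p) (hLS : L * PowerSeries.map (toUnr p) PS ∣ LS) (hS : S.Finite)
    (R' : ℕ → Type v) [∀ m, CommRing (R' m)] [∀ m, IsNoetherianRing (R' m)] [∀ m, IsDomain (R' m)]
    [∀ m, UniqueFactorizationMonoid (R' m)] [∀ m, Algebra (IwasawaAlgebra p) (R' m)]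
    (S' : ℕ → Type w) [∀ m, CommRing (S' m)] [∀ m, Algebra (UnrSeries p) (S' m)]
    [∀ m, Module.FaithfullyFlat (UnrSeries p) (S' m)] (φ' : ∀ m, R' m →+* S' m)
    (hφ' : ∀ m, (φ' m).comp (algebraMap (IwasawaAlgebra p) (R' m)) =
      (algebraMap (UnrSeries p) (S' m)).comp (PowerSeries.map (toUnr p)))
    (Nm : ℕ → Type) [∀ m, AddCommGroup (Nm m)] [∀ m, Module (R' m) (Nm m)]
    [∀ m, Module.Finite (R' m) (Nm m)] (Lm : ∀ m, S' m)
    (e : ∀ m : ℕ, 1 ≤ m →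
      (((R' m ⊗[IwasawaAlgebra p] XAc (W.baseChange K) p κ 𝔭 S γ) ⧸
          (((Ideal.span {(PowerSeries.C (p : ℤ_[p]) : IwasawaAlgebra p)}).map
              (algebraMap (IwasawaAlgebra p) (R' m))) ^ m •
            (⊤ : Submodule (R' m) (R' m ⊗[IwasawaAlgebra p] XAc (W.baseChange K) p κ 𝔭 S γ))))
          ≃ₗ[R' m]
        (Nm m ⧸ (((Ideal.span {(PowerSeries.C (p : ℤ_[p]) : IwasawaAlgebra p)}).map
            (algebraMap (IwasawaAlgebra p) (R' m))) ^ m • (⊤ : Submodule (R' m) (Nm m))))))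
    (hCh : ∀ m : ℕ, 1 ≤ m → Module.IsTorsion (R' m) (Nm m) →
      (Module.charIdeal (R' m) (Nm m)).map (φ' m) ≤ Ideal.span {Lm m})
    (hc : ∀ m : ℕ, 1 ≤ m →
      Ideal.span {Lm m} ≤
        Ideal.span {algebraMap (UnrSeries p) (S' m) LS} ⊔
          (((Ideal.span {(PowerSeries.C (p : ℤ_[p]) : IwasawaAlgebra p)}).map
              (PowerSeries.map (toUnr p))).map (algebraMap (UnrSeries p) (S' m))) ^ m) :
    P2.RoadFF.FittingCongruenceFrameAt W p κ 𝔭 γ ι f S PS :=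
  ⟨ΩK, Ωp, L, LS, hΩ, hL, hLS,
    AcSelmer.XAc.map_fittingIdeal_le_span_of_oneSided_congruences_descent_le_printed (W.baseChange K) p κ
      𝔭 γ hS LS R' S' φ' hφ' Nm Lm e hCh hc⟩

omit [W.IsElliptic] in
/-- **The member-level cut of record feeds the `Σ`-data predicate** (verbatim conjuncts).
[cite: Castella2018Erratum, proof of Thm. 1.1 (p. 4)] -/
theorem P2.RoadFF.sigmaDataAt_of_memberSupplyAt
    {Mem : ℕ → ModuleCat.{0} (IwasawaAlgebra p) → UnrSeries p → Prop}
    (hsup : P2.RoadFF.MemberSupplyAt W p κ 𝔭 γ S PS Mem) :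
    P2.RoadFF.SigmaDataAt W p κ 𝔭 γ S PS :=
  ⟨hsup.1, hsup.2.1, hsup.2.2.1, hsup.2.2.2.1⟩

end Feed

/-! ### `Λ`-members (`d = 1`) are members over the trivial coefficient square -/

section SingleRing

universe u

variable {R : Type u} [CommRing R] (I : Ideal R) {M : Type*} [AddCommGroup M] [Module R M]
  {N' : Type*} [AddCommGroup N'] [Module R N']

/-- Transport of a congruence isomorphism `M/I^m ≅ N/I^m` over `R` to
`(R ⊗_R M)/(I·R)^m(R ⊗ M) ≅ N/(I·R)^m` along `TensorProduct.lid` (`I.map (algebraMap R R) = I`): a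
`Λ`-member is a member over the trivial coefficient square. Pure linear algebra (stated as `Nonempty` so
that this file stays theorem-only). [cite: StacksProject, Tag 07ZA (3) (trivial base change)] -/
theorem CongruenceDescent.nonempty_quotEquiv_of_lid (m : ℕ)
    (e : (M ⧸ (I ^ m • (⊤ : Submodule R M))) ≃ₗ[R] (N' ⧸ (I ^ m • (⊤ : Submodule R N')))) :
    Nonempty (((R ⊗[R] M) ⧸ ((I.map (algebraMap R R)) ^ m • (⊤ : Submodule R (R ⊗[R] M)))) ≃ₗ[R]
      (N' ⧸ ((I.map (algebraMap R R)) ^ m • (⊤ : Submodule R N')))) :=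
  have hI : I.map (algebraMap R R) = I := by
    rw [Algebra.algebraMap_self, Ideal.map_id]
  ⟨(Submodule.Quotient.equiv ((I.map (algebraMap R R)) ^ m • ⊤) (I ^ m • ⊤) (TensorProduct.lid R M)
      (by rw [hI, Submodule.map_smul'', Submodule.map_top, LinearEquiv.range])) ≪≫ₗ e ≪≫ₗ
    Submodule.quotEquivOfEq _ _ (by rw [hI])⟩

end SingleRing

section FeedSingle

variable {K : Type} [Field K] [NumberField K] {W : WeierstrassCurve ℚ} [W.IsElliptic] {p : ℕ}
  [Fact p.Prime] {κ : ZpExtension K p} {𝔭 : HeightOneSpectrum (𝓞 K)} {γ : Field.absoluteGaloisGroup K}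
  [Fact (κ.IsTopGenerator γ)] {ι : PadicAlgCl p ≃+* ℂ} {N : ℕ}
  {f : CuspForm (CongruenceSubgroup.Gamma0 N) 2}
  {S : Set (HeightOneSpectrum (𝓞 K))} {PS : IwasawaAlgebra p}
  {Mem : ℕ → ModuleCat.{0} (IwasawaAlgebra p) → UnrSeries p → Prop}

/-- **The member-level cut of record (members over the single ring `Λ`, `d = 1`) feeds the Fitting-level
congruence frame**: `MemberSupplyAt ∧ MemberDivisibilityAt ∧ ValueCongruenceLeAt ⟹ FittingCongruenceFrameAt`
— the `Λ`-members are members over the trivial coefficient square `Λ → Λ →(φ) R₀⟦T⟧ ← R₀⟦T⟧`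
(`R₀⟦T⟧` faithfully flat over itself), (2.5)_m printed over the Noetherian UFD `Λ`. Unconditional in the
three predicates. [cite: Castella2018Erratum, proof of Thm. 1.1 (p. 4), read one-sidedly] -/
theorem P2.RoadFF.fittingCongruenceFrameAt_of_roadFF
    (hsup : P2.RoadFF.MemberSupplyAt W p κ 𝔭 γ S PS Mem)
    (hdiv : P2.RoadFF.MemberDivisibilityAt p Mem)
    (hval : P2.RoadFF.ValueCongruenceLeAt p κ 𝔭 γ ι f PS Mem) :
    P2.RoadFF.FittingCongruenceFrameAt W p κ 𝔭 γ ι f S PS := by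
  obtain ⟨hS, -, -, -, Nm, Lm, hfin, hmem⟩ := hsup
  obtain ⟨ΩK, Ωp, L, LS, hΩ, hL, hLS, hc⟩ := hval
  haveI : ∀ m, Module.Finite (IwasawaAlgebra p) (Nm m) := hfin
  refine P2.RoadFF.fittingCongruenceFrameAt_of_members_descent_le_printed hΩ hL LS hLS hS
    (fun _ ↦ IwasawaAlgebra p) (fun _ ↦ UnrSeries p) (fun _ ↦ PowerSeries.map (toUnr p))
    (fun _ ↦ by rw [Algebra.algebraMap_self, Algebra.algebraMap_self, RingHom.comp_id, RingHom.id_comp])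
    (fun m ↦ Nm m) (fun m ↦ Lm m)
    (fun m hm ↦ (CongruenceDescent.nonempty_quotEquiv_of_lid _ m (hmem m hm).2.some).some)
    (fun m hm hNt ↦ hdiv m hm (Nm m) (Lm m) (hmem m hm).1 hNt)
    (fun m hm ↦ ?_)
  have h := hc m hm (Nm m) (Lm m) (hmem m hm).1
  rw [Algebra.algebraMap_self, RingHom.id_apply, Ideal.map_id, HidaLimitAlgebra.map_span_C_p]
  exact h

end FeedSingle

end Summit.BirchSwinnertonDyer.Rank1Residual.X11b

end
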